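import Literature.AlgebraicGeometry.Motives.GaloisThickeningQuotient
import Literature.AlgebraicGeometry.Motives.ProjectiveOfGeneratingSections
import Literature.AlgebraicGeometry.Morphisms.ProjectiveMorphismComposition
import Mathlib.AlgebraicGeometry.Morphisms.Smooth
import Mathlib.AlgebraicGeometry.Morphisms.Proper
import Mathlib.AlgebraicGeometry.Morphisms.Finite
import HarnessLib

/-!
# The Galois thickening preserves properness, smoothness of relative dimension `n`, separatedness and projectivity

Topic `Literature/AlgebraicGeometry/Motives`, namespace `Literature.AlgebraicGeometry.Motives`.  THEOREMS ONLY; no definition, no named fact,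
no instance, no notation, no `sorry`.  Sequel of ★ `Motives/GaloisThickening` (`thickening K L : SchemeOver K ⥤ SchemeOver K`,
`R_L X = (X ⊗_K L → Spec L → Spec K)`, `thickeningπ`).  Cell `hodgecm-mathlib`, P6 «MOD programme», organ «GAL-5» = item (Y-SP) of the ED.-2 census of
the sub-line `Cruxes/HLiu418/Lines/F0_P6a_ModuliDatum.lean` (desk F0P6a-plan (g0), `F0/P6/F0P6a-plan/ED2-CENSUS-P6a.v1.F0P6a-plan-g0.md` §2:
«`Y` is smooth of relative dimension 1 and proper (indeed projective) over `F`: record (F1) + base change to `Fᵢ` + composition with the finite étale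
`Spec Fᵢ → Spec F`»).  HC_CM is proved only modulo the printed citations until rung 0 closes; nothing here is about HC.

THE MATHEMATICS.  `R_L X → Spec K` is the composite `X ×_K Spec L → Spec L → Spec K` of a base change of `X → Spec K` with the finite morphism
`Spec L → Spec K` (`L ∕ K` a finite field extension), which is moreover étale when `L ∕ K` is separable.  Properness, separatedness and smoothness
of a fixed relative dimension are stable under base change and composition ([GortzWedhorn2020] Prop. 12.58, Prop. 9.8 ∕ App. C; [EGAIV4] 17.3.3,
17.10.2 (smooth of relative dimension `n` composed with étale = relative dimension `n + 0`)), so `R_L X` inherits them from `X` (`isProper_thickening_hom`,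
`isSeparated_thickening_hom`, `smoothOfRelativeDimension_thickening_hom`).  For projectivity over the field `K`: `π_X : R_L X → X` is FINITE (base
change of `Spec L → Spec K`), so composing with a closed `K`-immersion `X ↪ ℙⁿ_K` gives a finite `K`-morphism `R_L X → ℙⁿ_K` from the proper
`K`-scheme `R_L X`, which is therefore projective over `K` ([GortzWedhorn2020] Thm. 13.84 (2) with Cor. 13.72 — the tree's ★
`isProjectiveOver_of_isFinite`): `isProjectiveOver_thickening`, `isProjective_thickening_hom`.

MAIN STATEMENTS.  `isFinite_bcSpec`, `isFinite_thickeningπ_left`, `isProper_bcSpec`, `isProper_thickening_hom`, `isSeparated_thickening_hom`,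
`smoothOfRelativeDimension_thickening_hom`, `isProjectiveOver_thickening`, `isProjective_thickening_hom` — the hypotheses `hXn`∕`hXpr` of ★
`IntegralModel.eventually_isSmoothProper_localise` and the projectivity input of ★ PROJ-SPREAD at `Y := R_{Fᵢ} M⋆_{Kc}`.

## References
* [GortzWedhorn2020] U. Görtz, T. Wedhorn, *Algebraic Geometry I* (2nd ed. 2020), Prop. 12.58 (proper: base change, composition), Prop. 9.13 (2)
  (separated: base change, composition), Thm. 13.84 (2) p. 408 with Cor. 13.72 p. 405 (proper + finite over `ℙⁿ` ⇒ projective).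
* [EGAIV4] A. Grothendieck, J. Dieudonné, *EGA IV₄*, 17.3.3 (iii), 17.10.2 (smooth morphisms and relative dimension: base change, composition).
* [Hartshorne1977] R. Hartshorne, *Algebraic Geometry*, II §4 (projective and proper morphisms).
-/

set_option autoImplicit false

noncomputable section

-- `((thickening K L).obj X).hom` against `pullback.snd _ _ ≫ bcSpec K L` is only syntactically equal after unfolding the `abbrev`s
-- (the ★ `Motives/IntegralModelOfGlobalModel` idiom).
set_option backward.isDefEq.respectTransparency false

open CategoryTheory AlgebraicGeometry Limits

universe u

namespace Literature.AlgebraicGeometry.Motives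

open Literature.AlgebraicGeometry.Morphisms
open Literature.AlgebraicGeometry.Motives.AbelianVariety (bcSpec)

variable {K L : Type u} [Field K] [Field L] [Algebra K L]

/-! ## §1 `Spec L → Spec K` and `π_X`: finite, proper -/

variable (K L) in
/-- `Spec L → Spec K` is finite for a finite extension `L ∕ K`. [cite: GortzWedhorn2020, Prop. 12.58] -/
theorem isFinite_bcSpec [FiniteDimensional K L] : IsFinite (bcSpec K L) := by
  rw [IsFinite.SpecMap_iff]
  change (algebraMap K L).Finite
  rw [RingHom.finite_algebraMap]
  infer_instance

variable (K L) in
/-- `Spec L → Spec K` is proper for a finite extension `L ∕ K` (finite morphisms are proper). [cite: GortzWedhorn2020, Prop. 12.58] -/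
theorem isProper_bcSpec [FiniteDimensional K L] : IsProper (bcSpec K L) :=
  haveI := isFinite_bcSpec K L
  inferInstance

/-- `π_X : X ×_K Spec L → X` is finite (base change of `Spec L → Spec K`). [cite: GortzWedhorn2020, Prop. 12.58] -/
theorem isFinite_thickeningπ_left [FiniteDimensional K L] (X : SchemeOver K) : IsFinite (thickeningπ (L := L) X).left := by
  rw [thickeningπ_left]
  exact MorphismProperty.pullback_fst _ _ (isFinite_bcSpec K L)

/-! ## §2 Properness, separatedness, smoothness of the thickening -/

/-- **`R_L X → Spec K` is proper if `X → Spec K` is** (base change + composition with the finite `Spec L → Spec K`).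
[cite: GortzWedhorn2020, Prop. 12.58] -/
theorem isProper_thickening_hom [FiniteDimensional K L] (X : SchemeOver K) [IsProper X.hom] :
    IsProper ((thickening K L).obj X).hom := by
  haveI := isProper_bcSpec K L
  rw [thickening_obj_hom]
  infer_instance

/-- **`R_L X → Spec K` is separated if `X → Spec K` is** (base change + composition with the separated `Spec L → Spec K`).
[cite: GortzWedhorn2020, Prop. 9.13 (2) (p. 234) and App. C (separated: base change, composition)] -/
theorem isSeparated_thickening_hom (X : SchemeOver K) [IsSeparated X.hom] : IsSeparated ((thickening K L).obj X).hom := by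
  rw [thickening_obj_hom]
  infer_instance

/-- **`R_L X → Spec K` is smooth of relative dimension `n` if `X → Spec K` is**, for `L ∕ K` finite separable (base change of `X → Spec K`,
composed with the étale — smooth of relative dimension `0` — morphism `Spec L → Spec K`: relative dimension `n + 0`).
[cite: EGAIV4, 17.3.3 (iii) and 17.10.2] -/
theorem smoothOfRelativeDimension_thickening_hom [FiniteDimensional K L] [Algebra.IsSeparable K L] {n : ℕ} (X : SchemeOver K)
    [SmoothOfRelativeDimension n X.hom] : SmoothOfRelativeDimension n ((thickening K L).obj X).hom := by
  haveI : Etale (bcSpec K L) := etale_bcSpec K L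
  haveI : SmoothOfRelativeDimension n (pullback.snd X.hom (bcSpec K L)) :=
    haveI := smoothOfRelativeDimension_isStableUnderBaseChange (n := n)
    MorphismProperty.pullback_snd _ _ inferInstance
  rw [thickening_obj_hom]
  exact (inferInstance : SmoothOfRelativeDimension (n + 0) (pullback.snd X.hom (bcSpec K L) ≫ bcSpec K L))

/-- `R_L X → Spec K` is locally of finite type if `X → Spec K` is. [cite: GortzWedhorn2020, Prop. 12.58] -/
theorem locallyOfFiniteType_thickening_hom [FiniteDimensional K L] (X : SchemeOver K) [LocallyOfFiniteType X.hom] :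
    LocallyOfFiniteType ((thickening K L).obj X).hom := by
  haveI := isFinite_bcSpec K L
  rw [thickening_obj_hom]
  infer_instance

/-! ## §3 Projectivity over `K` -/

/-- **`R_L X` is projective over `K` if `X` is** (`L ∕ K` finite): `R_L X → X ↪ ℙⁿ_K` is a FINITE `K`-morphism from the proper `K`-scheme `R_L X`,
hence `R_L X` is projective over `K` (the tree's ★ `isProjectiveOver_of_isFinite`, [GortzWedhorn2020] Thm. 13.84 (2) with Cor. 13.72).
[cite: GortzWedhorn2020, Thm. 13.84 (2) (p. 408) with Cor. 13.72 (p. 405)] -/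
theorem isProjectiveOver_thickening [FiniteDimensional K L] (X : SchemeOver K) (h : IsProjectiveOver X) :
    IsProjectiveOver ((thickening K L).obj X) := by
  obtain ⟨n, ι, hι⟩ := h
  haveI := hι
  haveI : IsProper X.hom := by
    have hX : IsProjective X.hom := IsProjective.of_isProjectiveOver ⟨n, ι, hι⟩
    exact hX.isProper
  haveI : IsProper ((thickening K L).obj X).hom := isProper_thickening_hom X
  haveI : IsFinite (thickeningπ (L := L) X).left := isFinite_thickeningπ_left X
  haveI : IsFinite (thickeningπ (L := L) X ≫ ι).left := by
    rw [Over.comp_left]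
    infer_instance
  exact isProjectiveOver_of_isFinite (thickeningπ (L := L) X ≫ ι)

/-- **`R_L X → Spec K` is a projective morphism if `X → Spec K` is** (`L ∕ K` finite; over a field the two notions agree, ★
`isProjective_hom_iff_isProjectiveOver`). [cite: GortzWedhorn2020, Thm. 13.84 (2) (p. 408) with Cor. 13.72 (p. 405)] -/
theorem isProjective_thickening_hom [FiniteDimensional K L] (X : SchemeOver K) (h : IsProjective X.hom) :
    IsProjective ((thickening K L).obj X).hom :=
  IsProjective.of_isProjectiveOver (isProjectiveOver_thickening X h.isProjectiveOver)

end Literature.AlgebraicGeometry.Motives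

end
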